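import Literature.Analysis.Asymptotics.LinearRecurrencePolynomialSource
import HarnessLib

/-!
# The fourth-central-moment algebra of a linear cumulant law: if the raw moment sums of orders `0…4` have polynomial laws of degrees `0…4` with
# geometric errors and the three leading cancellations hold, then `m₄ − 3·Var² − (w₁/A⁴)·K → w₀/A⁴` (module «FOURTH CENTRAL MOMENT ALGEBRA»)

Topic `Literature/Analysis/Asymptotics` (model-free plumbing on real sequences; companion of the lane's variance algebra `W2.tendsto_ratio_var_sub_linear`
(«WIDTH-TWO CONTACT VARIANCE RATE») and third-central-moment algebra `W3.tendsto_ratio_third_central_sub_linear` («WIDTH-THREE CONTACT SKEWNESS»)).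
Lane «pcv-sawmu» (CriticalPhenomena venture), a-p2 g29 — the last model-free input of the FOURTH contact cumulant of the critical strips: with
`D → A`, `C ≈ μ₁K + μ₀`, `Q ≈ q₂K² + q₁K + q₀`, `P ≈ p₃K³ + …`, `S ≈ s₄K⁴ + …` (`K = k+1`, errors `o(K⁻⁴), o(K⁻³), o(K⁻²), o(K⁻¹), o(1)`), the fourth central
moment `m₄ = S/D − 4(P/D)(C/D) + 6(Q/D)(C/D)² − 3(C/D)⁴` minus `3·Var²` (`Var = Q/D − (C/D)²`) is LINEAR: `m₄ − 3Var² − (w₁/A⁴)K → w₀/A⁴`, provided the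
`K⁴, K³, K²` coefficients of `E(K) := S₀A³ − 4P₀C₀A² − 3Q₀²A² + 12Q₀C₀²A − 6C₀⁴` vanish (three identities among the leading coefficients — for cumulant-type
sums they are forced).  Frame: W. Feller I (1968) XIII.6; the expansion is the exact Taylor expansion of the quartic form.  Nothing is quoted AS PRINTED.

## What is proved (namespace `Literature.Analysis`)
★★ `tendsto_ratio_fourth_central_sub_linear`.

Label: LANE THEOREM (own arrangement of lane «pcv-sawmu», a-p2 g29, 2026-08-28).  NOT claimed: higher orders (the pattern is the Taylor expansion of the
cumulant polynomial), optimal hypotheses.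
-/

noncomputable section

open Finset Filter Topology

namespace Literature.Analysis

set_option maxHeartbeats 1600000 in
/-- ★★ **Fourth central moment algebra** (plumbing).  See the module docstring: with the rates `K⁴(D−A) → 0`, `K³(C − C₀) → 0`, `K²(Q − Q₀) → 0`, `K(P − P₀) → 0`,
`S − S₀ → 0` (`C₀ = μ₁K + μ₀`, `Q₀, P₀, S₀` the polynomials of degrees 2, 3, 4), `A ≠ 0`, and the vanishing of the `K⁴, K³, K²` coefficients of
`E = S₀A³ − 4P₀C₀A² − 3Q₀²A² + 12Q₀C₀²A − 6C₀⁴`, one has `S/D − 4(P/D)(C/D) − 3(Q/D)² + 12(Q/D)(C/D)² − 6(C/D)⁴ − (w₁/A⁴)K → w₀/A⁴` where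
`w₁, w₀` are the `K¹, K⁰` coefficients of `E` (the left side is `m₄ − 3Var²`). [cite: Feller1968, XIII.6 (moments of the number of renewals); lane «pcv-sawmu» a-p2 g29 — plumbing] -/
theorem tendsto_ratio_fourth_central_sub_linear {D C Q P S : ℕ → ℝ} {A μ₁ μ₀ q₂ q₁ q₀ p₃ p₂ p₁ p₀ s₄ s₃ s₂ s₁ s₀ : ℝ} (hA : A ≠ 0)
    (h4 : A ^ 3 * s₄ - 4 * A ^ 2 * p₃ * μ₁ - 3 * A ^ 2 * q₂ ^ 2 + 12 * A * q₂ * μ₁ ^ 2 - 6 * μ₁ ^ 4 = 0)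
    (h3 : A ^ 3 * s₃ - 4 * A ^ 2 * (p₃ * μ₀ + p₂ * μ₁) - 6 * A ^ 2 * q₂ * q₁ + 12 * A * (2 * q₂ * μ₁ * μ₀ + q₁ * μ₁ ^ 2) - 24 * μ₁ ^ 3 * μ₀ = 0)
    (h2 : A ^ 3 * s₂ - 4 * A ^ 2 * (p₂ * μ₀ + p₁ * μ₁) - 3 * A ^ 2 * (q₁ ^ 2 + 2 * q₂ * q₀) + 12 * A * (q₂ * μ₀ ^ 2 + 2 * q₁ * μ₁ * μ₀ + q₀ * μ₁ ^ 2)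
      - 36 * μ₁ ^ 2 * μ₀ ^ 2 = 0)
    (hD : Tendsto (fun k : ℕ => ((k : ℝ) + 1) ^ 4 * (D k - A)) atTop (𝓝 0))
    (hC : Tendsto (fun k : ℕ => ((k : ℝ) + 1) ^ 3 * (C k - (μ₁ * ((k : ℝ) + 1) + μ₀))) atTop (𝓝 0))
    (hQ : Tendsto (fun k : ℕ => ((k : ℝ) + 1) ^ 2 * (Q k - (q₂ * ((k : ℝ) + 1) ^ 2 + q₁ * ((k : ℝ) + 1) + q₀))) atTop (𝓝 0))
    (hP : Tendsto (fun k : ℕ => ((k : ℝ) + 1) * (P k - (p₃ * ((k : ℝ) + 1) ^ 3 + p₂ * ((k : ℝ) + 1) ^ 2 + p₁ * ((k : ℝ) + 1) + p₀))) atTop (𝓝 0))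
    (hS : Tendsto (fun k : ℕ => S k - (s₄ * ((k : ℝ) + 1) ^ 4 + s₃ * ((k : ℝ) + 1) ^ 3 + s₂ * ((k : ℝ) + 1) ^ 2 + s₁ * ((k : ℝ) + 1) + s₀)) atTop (𝓝 0)) :
    Tendsto (fun k : ℕ => S k / D k - 4 * (P k / D k) * (C k / D k) - 3 * (Q k / D k) ^ 2 + 12 * (Q k / D k) * (C k / D k) ^ 2 - 6 * (C k / D k) ^ 4
      - (A ^ 3 * s₁ - 4 * A ^ 2 * (p₁ * μ₀ + p₀ * μ₁) - 6 * A ^ 2 * q₁ * q₀ + 12 * A * (q₁ * μ₀ ^ 2 + 2 * q₀ * μ₁ * μ₀) - 24 * μ₁ * μ₀ ^ 3) / A ^ 4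
        * ((k : ℝ) + 1)) atTop
      (𝓝 ((A ^ 3 * s₀ - 4 * A ^ 2 * p₀ * μ₀ - 3 * A ^ 2 * q₀ ^ 2 + 12 * A * q₀ * μ₀ ^ 2 - 6 * μ₀ ^ 4) / A ^ 4)) := by
  set w₁ : ℝ := A ^ 3 * s₁ - 4 * A ^ 2 * (p₁ * μ₀ + p₀ * μ₁) - 6 * A ^ 2 * q₁ * q₀ + 12 * A * (q₁ * μ₀ ^ 2 + 2 * q₀ * μ₁ * μ₀) - 24 * μ₁ * μ₀ ^ 3 with hw₁
  set w₀ : ℝ := A ^ 3 * s₀ - 4 * A ^ 2 * p₀ * μ₀ - 3 * A ^ 2 * q₀ ^ 2 + 12 * A * q₀ * μ₀ ^ 2 - 6 * μ₀ ^ 4 with hw₀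
  have hinv : Tendsto (fun k : ℕ => ((k : ℝ) + 1)⁻¹) atTop (𝓝 0) := by
    have := (tendsto_one_div_add_atTop_nhds_zero_nat : Tendsto (fun n : ℕ => 1 / ((n : ℝ) + 1)) atTop (𝓝 0))
    simpa using this
  have hKne : ∀ k : ℕ, ((k : ℝ) + 1) ≠ 0 := fun k => by positivity
  -- D → A, eventually D ≠ 0
  have hD0 : Tendsto (fun k : ℕ => D k - A) atTop (𝓝 0) := by
    have t := hD.mul ((hinv.mul hinv).mul (hinv.mul hinv)); rw [zero_mul] at t
    refine t.congr fun k => ?_; field_simp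
  have hDA : Tendsto D atTop (𝓝 A) := by have := hD0.add_const A; simpa using this
  have hDne : ∀ᶠ k : ℕ in atTop, D k ≠ 0 := hDA.eventually_ne hA
  have hDinv : Tendsto (fun k : ℕ => (D k)⁻¹) atTop (𝓝 A⁻¹) := hDA.inv₀ hA
  -- the four ratio errors
  set εx : ℕ → ℝ := fun k => C k / D k - (μ₁ * ((k : ℝ) + 1) + μ₀) / A with hεx
  set εy : ℕ → ℝ := fun k => Q k / D k - (q₂ * ((k : ℝ) + 1) ^ 2 + q₁ * ((k : ℝ) + 1) + q₀) / A with hεy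
  set εz : ℕ → ℝ := fun k => P k / D k - (p₃ * ((k : ℝ) + 1) ^ 3 + p₂ * ((k : ℝ) + 1) ^ 2 + p₁ * ((k : ℝ) + 1) + p₀) / A with hεz
  set εs : ℕ → ℝ := fun k => S k / D k - (s₄ * ((k : ℝ) + 1) ^ 4 + s₃ * ((k : ℝ) + 1) ^ 3 + s₂ * ((k : ℝ) + 1) ^ 2 + s₁ * ((k : ℝ) + 1) + s₀) / A
    with hεs
  -- `K³ εx → 0`
  have hx3 : Tendsto (fun k : ℕ => ((k : ℝ) + 1) ^ 3 * εx k) atTop (𝓝 0) := by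
    have t1 := hC.mul hDinv
    have t2 := ((hinv.const_mul μ₀).const_add μ₁).mul (hD.mul (hDinv.const_mul A⁻¹))
    have t := t1.sub t2
    simp only [mul_zero, zero_mul, add_zero, sub_zero] at t
    refine t.congr' ?_
    filter_upwards [hDne] with k hk
    rw [hεx]; field_simp; ring
  -- `K² εy → 0`
  have hy2 : Tendsto (fun k : ℕ => ((k : ℝ) + 1) ^ 2 * εy k) atTop (𝓝 0) := by
    have t1 := hQ.mul hDinv
    have t2 := ((((hinv.mul hinv).const_mul q₀).add (hinv.const_mul q₁)).const_add q₂).mul (hD.mul (hDinv.const_mul A⁻¹))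
    have t := t1.sub t2
    simp only [mul_zero, zero_mul, add_zero, sub_zero] at t
    refine t.congr' ?_
    filter_upwards [hDne] with k hk
    rw [hεy]; field_simp; ring
  -- `K εz → 0`
  have hz1 : Tendsto (fun k : ℕ => ((k : ℝ) + 1) * εz k) atTop (𝓝 0) := by
    have t1 := hP.mul hDinv
    have t2 := (((((hinv.mul (hinv.mul hinv)).const_mul p₀).add ((hinv.mul hinv).const_mul p₁)).add (hinv.const_mul p₂)).const_add p₃).mul
      (hD.mul (hDinv.const_mul A⁻¹))
    have t := t1.sub t2
    simp only [mul_zero, zero_mul, add_zero, sub_zero] at t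
    refine t.congr' ?_
    filter_upwards [hDne] with k hk
    rw [hεz]; field_simp; ring
  -- `εs → 0`
  have hs0 : Tendsto εs atTop (𝓝 0) := by
    have t1 := hS.mul hDinv
    have t2 := ((((((hinv.mul (hinv.mul (hinv.mul hinv))).const_mul s₀).add ((hinv.mul (hinv.mul hinv)).const_mul s₁)).add
      ((hinv.mul hinv).const_mul s₂)).add (hinv.const_mul s₃)).const_add s₄).mul (hD.mul (hDinv.const_mul A⁻¹))
    have t := t1.sub t2
    simp only [mul_zero, zero_mul, add_zero, sub_zero] at t
    refine t.congr' ?_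
    filter_upwards [hDne] with k hk
    rw [hεs]; field_simp; ring
  -- lower powers
  have lower : ∀ {e : ℕ → ℝ} {j : ℕ}, Tendsto (fun k : ℕ => ((k : ℝ) + 1) ^ (j + 1) * e k) atTop (𝓝 0) →
      Tendsto (fun k : ℕ => ((k : ℝ) + 1) ^ j * e k) atTop (𝓝 0) := by
    intro e j h
    have t := h.mul hinv; rw [zero_mul] at t
    exact t.congr fun k => by rw [pow_succ]; field_simp
  have hx2 : Tendsto (fun k : ℕ => ((k : ℝ) + 1) ^ 2 * εx k) atTop (𝓝 0) := lower hx3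
  have hx1 : Tendsto (fun k : ℕ => ((k : ℝ) + 1) ^ 1 * εx k) atTop (𝓝 0) := lower hx2
  have hx0' : Tendsto (fun k : ℕ => ((k : ℝ) + 1) ^ 0 * εx k) atTop (𝓝 0) := lower hx1
  have hx0 : Tendsto εx atTop (𝓝 0) := by simpa using hx0'
  have hy1 : Tendsto (fun k : ℕ => ((k : ℝ) + 1) ^ 1 * εy k) atTop (𝓝 0) := lower hy2
  have hy0' : Tendsto (fun k : ℕ => ((k : ℝ) + 1) ^ 0 * εy k) atTop (𝓝 0) := lower hy1
  have hy0 : Tendsto εy atTop (𝓝 0) := by simpa using hy0'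
  have hz1' : Tendsto (fun k : ℕ => ((k : ℝ) + 1) ^ 1 * εz k) atTop (𝓝 0) := by simpa using hz1
  have hz0' : Tendsto (fun k : ℕ => ((k : ℝ) + 1) ^ 0 * εz k) atTop (𝓝 0) := lower hz1'
  have hz0 : Tendsto εz atTop (𝓝 0) := by simpa using hz0'
  -- scaled model quantities converge: C₀/K → μ₁, Q₀/K² → q₂, P₀/K³ → p₃
  have hc0 : Tendsto (fun k : ℕ => (μ₁ * ((k : ℝ) + 1) + μ₀) * ((k : ℝ) + 1)⁻¹) atTop (𝓝 μ₁) := by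
    have t := (hinv.const_mul μ₀).const_add μ₁; rw [mul_zero, add_zero] at t
    exact t.congr fun k => by field_simp
  have hq0 : Tendsto (fun k : ℕ => (q₂ * ((k : ℝ) + 1) ^ 2 + q₁ * ((k : ℝ) + 1) + q₀) * (((k : ℝ) + 1) ^ 2)⁻¹) atTop (𝓝 q₂) := by
    have t := (((hinv.mul hinv).const_mul q₀).add (hinv.const_mul q₁)).const_add q₂; simp only [mul_zero, add_zero] at t
    exact t.congr fun k => by field_simp; ring
  have hp0 : Tendsto (fun k : ℕ => (p₃ * ((k : ℝ) + 1) ^ 3 + p₂ * ((k : ℝ) + 1) ^ 2 + p₁ * ((k : ℝ) + 1) + p₀) * (((k : ℝ) + 1) ^ 3)⁻¹) atTop (𝓝 p₃) := by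
    have t := ((((hinv.mul (hinv.mul hinv)).const_mul p₀).add ((hinv.mul hinv).const_mul p₁)).add (hinv.const_mul p₂)).const_add p₃
    simp only [mul_zero, add_zero] at t
    exact t.congr fun k => by field_simp; ring
  -- the exact part
  have hN0 : ∀ k : ℕ,
      (s₄ * ((k : ℝ) + 1) ^ 4 + s₃ * ((k : ℝ) + 1) ^ 3 + s₂ * ((k : ℝ) + 1) ^ 2 + s₁ * ((k : ℝ) + 1) + s₀) * A ^ 3
      - 4 * (p₃ * ((k : ℝ) + 1) ^ 3 + p₂ * ((k : ℝ) + 1) ^ 2 + p₁ * ((k : ℝ) + 1) + p₀) * (μ₁ * ((k : ℝ) + 1) + μ₀) * A ^ 2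
      - 3 * (q₂ * ((k : ℝ) + 1) ^ 2 + q₁ * ((k : ℝ) + 1) + q₀) ^ 2 * A ^ 2
      + 12 * (q₂ * ((k : ℝ) + 1) ^ 2 + q₁ * ((k : ℝ) + 1) + q₀) * (μ₁ * ((k : ℝ) + 1) + μ₀) ^ 2 * A
      - 6 * (μ₁ * ((k : ℝ) + 1) + μ₀) ^ 4 = w₁ * ((k : ℝ) + 1) + w₀ := by
    intro k
    rw [hw₁, hw₀]
    linear_combination ((k : ℝ) + 1) ^ 4 * h4 + ((k : ℝ) + 1) ^ 3 * h3 + ((k : ℝ) + 1) ^ 2 * h2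
  -- abbreviations for the model quantities
  set x0 : ℕ → ℝ := fun k => (μ₁ * ((k : ℝ) + 1) + μ₀) / A with hx0d
  set y0 : ℕ → ℝ := fun k => (q₂ * ((k : ℝ) + 1) ^ 2 + q₁ * ((k : ℝ) + 1) + q₀) / A with hy0d
  set z0 : ℕ → ℝ := fun k => (p₃ * ((k : ℝ) + 1) ^ 3 + p₂ * ((k : ℝ) + 1) ^ 2 + p₁ * ((k : ℝ) + 1) + p₀) / A with hz0d
  -- the error expansion (exact Taylor expansion of the quartic form)
  have key : ∀ k : ℕ, S k / D k - 4 * (P k / D k) * (C k / D k) - 3 * (Q k / D k) ^ 2 + 12 * (Q k / D k) * (C k / D k) ^ 2 - 6 * (C k / D k) ^ 4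
      - w₁ / A ^ 4 * ((k : ℝ) + 1) - w₀ / A ^ 4
      = εs k - 4 * (z0 k * εx k + x0 k * εz k + εz k * εx k) - 3 * (2 * y0 k * εy k + εy k ^ 2)
        + 12 * (y0 k * (2 * x0 k * εx k + εx k ^ 2) + εy k * (x0 k ^ 2 + 2 * x0 k * εx k + εx k ^ 2))
        - 6 * (4 * x0 k ^ 3 * εx k + 6 * x0 k ^ 2 * εx k ^ 2 + 4 * x0 k * εx k ^ 3 + εx k ^ 4) := by
    intro k
    have e0 : (s₄ * ((k : ℝ) + 1) ^ 4 + s₃ * ((k : ℝ) + 1) ^ 3 + s₂ * ((k : ℝ) + 1) ^ 2 + s₁ * ((k : ℝ) + 1) + s₀) / A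
        - 4 * z0 k * x0 k - 3 * y0 k ^ 2 + 12 * y0 k * x0 k ^ 2 - 6 * x0 k ^ 4
        = ((s₄ * ((k : ℝ) + 1) ^ 4 + s₃ * ((k : ℝ) + 1) ^ 3 + s₂ * ((k : ℝ) + 1) ^ 2 + s₁ * ((k : ℝ) + 1) + s₀) * A ^ 3
          - 4 * (p₃ * ((k : ℝ) + 1) ^ 3 + p₂ * ((k : ℝ) + 1) ^ 2 + p₁ * ((k : ℝ) + 1) + p₀) * (μ₁ * ((k : ℝ) + 1) + μ₀) * A ^ 2
          - 3 * (q₂ * ((k : ℝ) + 1) ^ 2 + q₁ * ((k : ℝ) + 1) + q₀) ^ 2 * A ^ 2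
          + 12 * (q₂ * ((k : ℝ) + 1) ^ 2 + q₁ * ((k : ℝ) + 1) + q₀) * (μ₁ * ((k : ℝ) + 1) + μ₀) ^ 2 * A
          - 6 * (μ₁ * ((k : ℝ) + 1) + μ₀) ^ 4) / A ^ 4 := by
      rw [hx0d, hy0d, hz0d]; field_simp
    have e : (s₄ * ((k : ℝ) + 1) ^ 4 + s₃ * ((k : ℝ) + 1) ^ 3 + s₂ * ((k : ℝ) + 1) ^ 2 + s₁ * ((k : ℝ) + 1) + s₀) / A
        - 4 * z0 k * x0 k - 3 * y0 k ^ 2 + 12 * y0 k * x0 k ^ 2 - 6 * x0 k ^ 4 = w₁ / A ^ 4 * ((k : ℝ) + 1) + w₀ / A ^ 4 := by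
      rw [e0, hN0 k]; ring
    rw [hεx, hεy, hεz, hεs]
    linear_combination e
  -- every error term tends to zero
  have a_zx : Tendsto (fun k : ℕ => z0 k * εx k) atTop (𝓝 0) := by
    have t := (hp0.mul hx3).mul_const A⁻¹; simp only [mul_zero, zero_mul] at t
    exact t.congr fun k => by rw [hz0d]; field_simp
  have a_xz : Tendsto (fun k : ℕ => x0 k * εz k) atTop (𝓝 0) := by
    have t := (hc0.mul hz1).mul_const A⁻¹; simp only [mul_zero, zero_mul] at t
    exact t.congr fun k => by rw [hx0d]; field_simp
  have a_yy : Tendsto (fun k : ℕ => y0 k * εy k) atTop (𝓝 0) := by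
    have t := (hq0.mul hy2).mul_const A⁻¹; simp only [mul_zero, zero_mul] at t
    exact t.congr fun k => by rw [hy0d]; field_simp
  have a_yxx : Tendsto (fun k : ℕ => y0 k * x0 k * εx k) atTop (𝓝 0) := by
    have t := ((hq0.mul hc0).mul hx3).mul_const (A⁻¹ ^ 2); simp only [mul_zero, zero_mul] at t
    exact t.congr fun k => by rw [hy0d, hx0d]; field_simp
  have a_yx2 : Tendsto (fun k : ℕ => y0 k * εx k ^ 2) atTop (𝓝 0) := by
    have t := (hq0.mul (hx1.mul hx1)).mul_const A⁻¹; simp only [mul_zero, zero_mul] at t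
    exact t.congr fun k => by rw [hy0d]; field_simp
  have a_x2y : Tendsto (fun k : ℕ => x0 k ^ 2 * εy k) atTop (𝓝 0) := by
    have t := ((hc0.mul hc0).mul hy2).mul_const (A⁻¹ ^ 2); simp only [mul_zero, zero_mul] at t
    exact t.congr fun k => by rw [hx0d]; field_simp
  have a_xyx : Tendsto (fun k : ℕ => x0 k * εy k * εx k) atTop (𝓝 0) := by
    have t := ((hc0.mul hy1).mul hx0).mul_const A⁻¹; simp only [mul_zero, zero_mul] at t
    exact t.congr fun k => by rw [hx0d]; field_simp
  have a_x3x : Tendsto (fun k : ℕ => x0 k ^ 3 * εx k) atTop (𝓝 0) := by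
    have t := (((hc0.mul hc0).mul hc0).mul hx3).mul_const (A⁻¹ ^ 3); simp only [mul_zero, zero_mul] at t
    exact t.congr fun k => by rw [hx0d]; field_simp
  have a_x2x2 : Tendsto (fun k : ℕ => x0 k ^ 2 * εx k ^ 2) atTop (𝓝 0) := by
    have t := ((hc0.mul hc0).mul (hx1.mul hx1)).mul_const (A⁻¹ ^ 2); simp only [mul_zero, zero_mul] at t
    exact t.congr fun k => by rw [hx0d]; field_simp
  have a_xx3 : Tendsto (fun k : ℕ => x0 k * εx k ^ 3) atTop (𝓝 0) := by
    have t := ((hc0.mul hx1).mul (hx0.mul hx0)).mul_const A⁻¹; simp only [mul_zero, zero_mul] at t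
    exact t.congr fun k => by rw [hx0d]; field_simp
  have hlim : Tendsto (fun k : ℕ => εs k - 4 * (z0 k * εx k + x0 k * εz k + εz k * εx k) - 3 * (2 * y0 k * εy k + εy k ^ 2)
        + 12 * (y0 k * (2 * x0 k * εx k + εx k ^ 2) + εy k * (x0 k ^ 2 + 2 * x0 k * εx k + εx k ^ 2))
        - 6 * (4 * x0 k ^ 3 * εx k + 6 * x0 k ^ 2 * εx k ^ 2 + 4 * x0 k * εx k ^ 3 + εx k ^ 4)) atTop (𝓝 0) := by
    have t := ((((hs0.sub (((a_zx.add a_xz).add (hz0.mul hx0)).const_mul 4)).sub (((a_yy.const_mul 2).add (hy0.pow 2)).const_mul 3)).add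
      ((((a_yxx.const_mul 2).add a_yx2).add ((a_x2y.add (a_xyx.const_mul 2)).add (hy0.mul (hx0.pow 2)))).const_mul 12)).sub
      ((((a_x3x.const_mul 4).add (a_x2x2.const_mul 6)).add ((a_xx3.const_mul 4).add (hx0.pow 4))).const_mul 6))
    simp only [mul_zero, add_zero, sub_zero, zero_pow two_ne_zero, zero_pow (by norm_num : (4 : ℕ) ≠ 0)] at t
    refine t.congr fun k => ?_
    ring
  have t := hlim.add_const (w₀ / A ^ 4)
  rw [zero_add] at t
  refine t.congr fun k => ?_
  rw [← key k]
  ring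

end Literature.Analysis
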